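import Literature.Analysis.FluidPDE.CKNMorreyRepresentation
import Literature.Analysis.FluidPDE.ParabolicRieszPotentialProofs
import HarnessLib

/-!
# Lemma 13.5 of Lemarié-Rieusset 2016 from the representation (13.50)–(13.52) alone

Analysis/FluidPDE proofs file for the named fact
`Literature.Analysis.FluidPDE.LemarieRieusset2016.lemma13_5_step` (`CKNMorreyBootstrap.lean`: one
step of the Morrey bootstrap proving Lemarié-Rieusset 2016, Lemma 13.5, pp. 475–477). The accepted
`CKNMorreyRepresentation.lean` proves the step from two named facts, Adams' inequality
`adams_parabolicRieszPotential` (Cor. 5.1) and the representation `step3_velocityBound`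
((13.50)–(13.52) with the classes of `γ⃗`, `η⃗`); the former is now a theorem
(`adams_parabolicRieszPotential_holds`, `ParabolicRieszPotentialProofs.lean`, on the maximal
function files `ParabolicMaximalFunction*.lean` and `ParabolicHedberg.lean`), so the step, and
Lemma 13.5, depend on the single analytic fact `step3_velocityBound`:

* `LemarieRieusset2016.lemma13_5_step_of_velocityBound : step3_velocityBound → lemma13_5_step`;
* `LemarieRieusset2016.lemma13_5_of_velocityBound : step3_velocityBound → lemma13_5`.

What `step3_velocityBound` still needs (see `CKNMorreyRepresentation.lean`): the heat-kernel
bounds and the Oseen kernel `e^{νtΔ}∇∂ⱼ∂ₗΔ⁻¹`, uniqueness for the heat equation in `𝒮'`, the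
pressure equation (13.19) and its localisation (13.51), and Calderón's first commutator theorem.

## References

* P. G. Lemarié-Rieusset, *The Navier–Stokes Problem in the 21st Century*, CRC Press (2016),
  Cor. 5.1 (p. 112), §13.9 Step 3 (pp. 474–477), Lemma 13.5 (p. 475). [LemarieRieusset2016]
-/

namespace Literature.Analysis.FluidPDE

namespace LemarieRieusset2016

/-- **The bootstrap step of Lemma 13.5 from the representation (13.50)–(13.52)**: Adams'
inequality being proved (`adams_parabolicRieszPotential_holds`), the accepted reduction
`lemma13_5_step_of` leaves only `step3_velocityBound`. [cite: LemarieRieusset2016, proof of Lemma 13.5 pp. 475–477] -/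
theorem lemma13_5_step_of_velocityBound (hR : step3_velocityBound) : lemma13_5_step :=
  lemma13_5_step_of adams_parabolicRieszPotential_holds hR

/-- **Lemma 13.5 from the representation (13.50)–(13.52)** (Lemarié-Rieusset 2016, Lemma 13.5,
p. 475): `step3_velocityBound → lemma13_5`, through the proved step and the proved iteration
`lemma13_5_of_step`. [cite: LemarieRieusset2016, Lemma 13.5 p. 475] -/
theorem lemma13_5_of_velocityBound (hR : step3_velocityBound) : lemma13_5 :=
  lemma13_5_of_step (lemma13_5_step_of_velocityBound hR)

end LemarieRieusset2016

end Literature.Analysis.FluidPDE
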